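import Mathlib
import HarnessLib
import HarnessLib.Audit
import Summits.NavierStokesRegularity.Statement
import Literature.Analysis.FluidPDE.ClassicalSolution
import Literature.Analysis.FluidPDE.LerayHopf
import Literature.Analysis.FluidPDE.SelfSimilarLiouville
import Literature.Analysis.FluidPDE.SuitableWeak
import Literature.Analysis.FluidPDE.NSWave0
import Literature.Analysis.FluidPDE.Vorticity
import Literature.Analysis.FluidPDE.AxisymmetricEuler
import Literature.Analysis.FluidPDE.RescaledEulerLerayMonodromy
import Summits.NavierStokesRegularity.NavierStokesRegularity.Theorems.AdiabaticEddyClayUniqueness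
import HarnessLib.Audit.Status.Attr

/-!
Route: EulerMelnikovDss

DORMANT since 2026-09-01T21:29:12Z (reconciler: no traction for 5 d (last activity item-evidence-added at 2026-08-27T20:35:08Z); parked, not closed — `ledger route dormant route-NavierStokesRegularity-EulerMelnikovDss --off` to reactiva) — unstaffed, not closed; items shared with open routes are served there. `ledger route dormant <id> --off` reactivates.

# Route EulerMelnikovDss — NavierStokesRegularity, NEGATIVE side (the large-constant end of Tsai's
Type-I DSS conjecture)
Card realised: NavierStokesRegularity/NavierStokesRegularity/large-constant-euler-melnikov.

## Thesis X ("it suffices to show"): BIFURCATION FROM A PERIODIC EULER FLOW AT C_* = ∞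
In backward similarity variables U(y,s) = √(−t)·u(√(−t)y, t), s = −log(−t), a Type-I λ-(R)DSS
ancient solution is a (2 log λ)-periodic orbit of ∂_sU + U·∇U + ∇P = 𝓛U, 𝓛 = Δ − ½(1 + y·∇).
Rescaling AMPLITUDE AND TIME by the temporal Type-I constant C_* = sup √(−t)|u| — W(y,σ) = U(y,
σ/C_*)/C_*, ε = 1/C_* — gives EXACTLY ∂_σW + W·∇W + ∇Π = ε𝓛W, sup|W| = 1, period 2C_* log λ: at
large Type-I constant a DSS profile is an incompressible EULER flow weakly perturbed by 'viscosity +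
inverse scaling drift'. X: there are a nontrivial smooth finite-energy Euler flow W₀ on ℝ×ℝ³,
time-periodic modulo an isometry and genuinely time-dependent, and Type-I rotated-λ_n-DSS ancient
mild solutions u_n with λ_n → 1⁺ and Type-I constants C_n → ∞ whose (amplitude,time)-rescaled
profiles converge locally uniformly to W₀. In particular Type-I (R)DSS profiles exist with factors
accumulating at 1 (crux FastBranchProfiles: ∀ δ>0 ∃ λ ∈ (1,1+δ) ∃ R, ¬RotatedTypeIDSSLiouville λ R),
which is ¬TypeIDSSLiouvilleConjecture read at the edge of Chae–Wolf's window
(ChaeWolf2017RemovingDSS Thm 1.3: λ_*(C_*) > 1 removes 1 < λ < λ_*; the fast branch lives at log λ =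
P₀/(2C_*), i.e. exactly where λ_* must degenerate as C_* → ∞).
Lean (Target, elaborates — Sketch.lean rc 0): ∃ W q P Q, 0 < P ∧ IsClassicalEulerSolutionOn univ 0 W
q ∧ (∀ σ y, W (σ+P) (Q y) = Q (W σ y)) ∧ (∃ σ y, W σ y ≠ W 0 y) ∧ ∃ (c C : ℕ → ℝ) R u, (∀ n, 1 < c
n) ∧ Tendsto c atTop (𝓝 1) ∧ (∀ n, 0 < C n) ∧ Tendsto C atTop atTop ∧ (∀ n, IsAncientMildSolution 1
(u n) ∧ measurable slices ∧ IsRotatedDSS (c n) (R n) (u n) ∧ (∃ C₀, HasTypeIDecay C₀ (u n)) ∧ ∀ t<0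
∀ x, √(−t)‖u n t x‖ ≤ C n) ∧ TendstoLocallyUniformly (fun n z ↦ (C n)⁻¹ • e^{−s/2} • u n (−e^{−s})
(e^{−s/2} • z.2), s = z.1/C n) (uncurry W) atTop.

## Assembly (formal; the deciding theorem `closes`, rev 4, native audit OK, axioms
propext/Classical.choice/Quot.sound)
FastBranchProfiles → RotatedDssBlowupBridge (stmt-NavierStokesRegularity-10475: (∃ λ R,
¬RotatedTypeIDSSLiouville λ R) → X5a — the rotated form of the truncation bridge stmt-0901 of route
DssFarFieldSlaving, equivalent to it by the accepted typeIDSSLiouvilleConjecture_iff; stated over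
the rotated Liouville predicate so that the cone names no undeclared conjecture: this route REFUTES
Tsai's wall, it never assumes it) → ClayUniqueness (X5b, stmt-0153, shared with Blowup) →
¬NavierStokesRegularity. Proof (glue, in the route file): δ := 1 gives λ ∈ (1,2), R with
¬RotatedTypeIDSSLiouville λ R; the bridge gives a maximal smooth Leray–Hopf solution with finite
lifespan from a rapidly decaying datum (X5a); Clay (A) applied to that datum plus X5b uniqueness on
[0,T) extends it smoothly past T, contradicting maximality (the argument of
Literature.NS.blowup_assembly, inlined).

## Two-layer plan (D-0019)
Layer 1 = the ranked cruxes below (the mechanism's three load-bearing claims + the output statement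
the assembly consumes); layer 2 (later, glued splits): FastBranchProfiles ← {seed
(PeriodicEulerSeed), linear solvability (FiniteMelnikovCokernel), nonlinear persistence with Type-I
tail matching}; nothing below that becomes an item.

Rationale: WHY THIS LINE. Tsai's Type-I DSS Liouville conjecture (TypeIDSSLiouvilleConjecture; Tsai2018 Conj.
8.8–8.9, BradshawTsai2017CPDE Open Problem 5.1) is known at three corners: λ-continuous profiles
(NecasRuzickaSverak1996, Tsai1998), 1 < λ < λ_*(C_*) (ChaeWolf2017RemovingDSS Thm 1.3 — proof:
compactness at FIXED Type-I constant C_*, limit λ_j → 1 is self-similar, Tsai's theorem;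
arXiv:1610.09464 §3) and small C_* (ibid. Rmk 1.4). The remaining axis is the AMPLITUDE C_* → ∞, and
there the problem changes nature: the exact (amplitude, time) rescaling W = U(·, σ/C_*)/C_* turns
the profile equation into ∂_σW + W·∇W + ∇Π = ε(ΔW − ½(W + y·∇W)), ε = 1/C_*, i.e. incompressible
EULER plus an O(ε) dissipative perturbation, with the DSS factor entering only through the period
2C_* log λ. This imports the Melnikov/averaging theory of periodic orbits of weakly dissipative
perturbations of conservative systems (GuckenheimerHolmes1983 ch. 4) with an explicit dictionary (ε
= 1/C_*, σ = C_* s, the scaling degree d_Q of each Euler invariant as the only Melnikov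
coefficient), the essential-spectrum theory of linearised Euler (FriedlanderVishik1991, Vishik1996,
Shvydkoy2006) as the named obstruction, and the new KAM/Nash–Moser technology for time-periodic 3-D
Euler vortex structures (GarciaHassainiaHmidi2026) as the seed factory. Nearest physics precedent:
Pomeau2017 / GinibreLeberrePomeau2019 (Euler–Leray selection by invariants, drift kept at leading
order). The route is the NEGATIVE reading (a named ansatz class for Blowup's crux #5 in the regime λ
→ 1⁺ that Chae–Wolf's compactness cannot reach); the positive reading is filed as the ¬-side items
UniformDssRemovalNearOne (= ¬FastBranchProfiles, equivalence proved in Sketch.lean) and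
LargeAmplitudeDssLiouville.
EXACT LAWS (planner's derivation, to be proved as support PeriodMomentLaws): along any decaying
solution of the rescaled system, d/dσ ∫y×Ω = ε∫y×Ω, d/dσ ∫|y|²Ω = (3ε/2)∫|y|²Ω, d/dσ ∫|W|² =
ε(½∫|W|² − 2∫|∇W|²), d/dσ H = −2ε∫Ω·curl Ω (Euler parts vanish; ∫W·(y·∇W) = −(3/2)∫|W|², ∫y×(y·∇Ω) =
−4∫y×Ω, ∫|y|²(y·∇Ω) = −5∫|y|²Ω). Periodicity modulo an isometry therefore forces on the Euler limit
W₀: impulse 0, angular impulse 0 (ALSO for rotated DSS, since |A| is rotation-invariant — this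
corrects the card's 'rotation locked to A'), size locking ⟨‖∇W₀‖²⟩ = ¼⟨‖W₀‖²⟩, zero mean helicity
dissipation; transported Casimirs of nonzero scaling degree (ω_θ/r, vol{ru_θ > c}) obstruct
axisymmetric seeds, reproducing KNSS2009 Thm 5.2 / SereginSverak2009 as Melnikov obstructions.
Caveat carried into the items: true profiles have a −1-homogeneous velocity tail
(BradshawPhelps2023, ChaeWolf2017RemovingDSS Thm 1.1), so the rules are stated for the LIMIT W₀
(typed in PeriodicEulerSeed/Target), never as convergent integrals on u.
RANKED CRUXES. #2 FastBranchProfiles (typed; consumed by the assembly): Type-I (R)DSS profiles with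
factors accumulating at 1. #3 FiniteMelnikovCokernel (typed at rev 6 over the landed
RescaledEulerLerayMonodromy vocabulary, repairing the refuter's misstated verdict: flat solenoidal
vorticity space L²_σ(ℝ³,dy), near-1 CLUSTER counted at scale ε): for every admissible seed and every
C > 0 the unique ε-monodromy M_ε of the linearisation at the seed has, uniformly for ε ∈ (0,ε₁), at
most m = m(seed,C) Floquet multipliers (total algebraic multiplicity, Riesz splitting) in the window
{|z−1| < C'ε} ∩ {|z| > e^{−εP₀θ}}, C' ∈ [C,2C], θ ∈ [1/16,1/8] — outside the far-field
Ornstein–Uhlenbeck disc |z| ≤ e^{−εP₀/4}, which on flat L² sits at distance ≈ εP₀/4 from 1 and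
forbids any fixed disc or uniform inverse bound; expected occupants: the continued neutral
directions of the seed (symmetry modes, gradients of E, I, A, H) — the card's refutation (i) lives
here and is the cheapest decisive test. #4 PeriodicEulerSeed (typed): a smooth finite-energy Euler
flow on ℝ×ℝ³, periodic modulo an isometry, genuinely time-dependent, rapidly decaying vorticity, I =
A = 0, zero mean helicity dissipation, no axis of symmetry. #5 StrongEulerLimit (typed a-priori
estimate): (−t)|∇u| ≤ K(1 + C_*) for every Type-I (R)DSS ancient mild solution — unit-amplitude
profiles have O(1) gradients, so large-constant profiles HAVE strong Euler limits (the frame of both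
readings; parabolic theory gives only K·C_*²).
KILL CRITERIA. UniformDssRemovalNearOne proved (λ_* independent of C_*) ⇒ #2 refuted ⇒ close
refuted:FastBranchProfiles. #3 refuted (an admissible seed whose ε-monodromies carry unboundedly
many multipliers within O(ε) of 1 outside the far-field disc as ε → 0 — a 'viscous sea' born from
the inviscid essential spectrum through 1, the Friedlander–Vishik / Orr–Sommerfeld scenario): if the
witness is a structural family (relative equilibria, period-resonant Kelvin modes) ⇒ sharpen
PeriodicEulerSeed to exclude it (one restate); if generic ⇒ mechanism dead: close exhausted (the
slow branch log λ = O(1) would be a new route, not a repair). #4 refuted (every such Euler flow is a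
relative equilibrium, and backward RSS profiles are excluded) ⇒ close. TypeIDSSLiouvilleConjecture
or NoBlowup (stmt-0054) proved ⇒ moot. LargeAmplitudeDssLiouville proved ⇒ record: with fixed-C_*
compactness it confines profiles to a compact amplitude window (positive-side harvest), and kills
#2.
NOT DECOMPOSED. Nonlinear persistence (Lyapunov–Schmidt / Nash–Moser in ε with the tail matched at
O(ε)); the slow branch (S); numerical Melnikov numbers of candidate seeds (kit job, later); the
truncation bridge internals (route DssFarFieldSlaving) and X5b (route Blowup). Prior-programme
inspiration notes: not read (plancard mode).
CHEAPEST FALSIFIER. Crux #3 numerically: discretise the linearised ε-monodromy M_ε at one model seed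
(a non-axisymmetric rigidly rotating vortex structure / Kelvin-wave ring, rotation absorbed in Q)
and count its eigenvalues in {|z−1| < Cε, |z| > e^{−εP₀/8}} at two values of ε (say ε and ε/4): a
count growing like a negative power of ε kills the line; a stable count equal to the number of
structural neutral directions supports it. Analytically cheapest: UniformDssRemovalNearOne (λ_*
independent of C_*) from a quantitative form of Chae–Wolf §3.
NUMBERS. Period 2C_* log λ; fast branch λ = exp(P₀/(2C_*)) → 1⁺; ε = 1/C_*; moment growth rates ε,
3ε/2; energy balance ¼; items at open 10 (target, assembly, 3 typed cruxes, 5 support of which 2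
shared: stmt-0901, stmt-0153) + 1 informal crux + 1 definition request added after open (rev 6: crux
#3 typed after the definition landed — RescaledEulerLerayMonodromy — and the refuter's misstated
verdict); negatives index: 0 refuted statements (2026-08-15).

Novelty: NOVELTY (searched 2026-08-15: `lit frontier NavierStokesRegularity --since 2022` (30 rows: forward
self-similar/DSS in 2-D or hypodissipative — arXiv:2601.03161, arXiv:2603.12497, arXiv:2601.03833 —,
non-uniqueness, ε-regularity; nothing on backward DSS at large constant), `lit bridges
NavierStokesRegularity --cross any`, `lit search --source crossref|zbmath` for "time periodic 3D
Euler compactly supported / leapfrogging time periodic / Gavrilov", `lit galaxy search "time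
periodic solutions of the 3D Euler" --star all` (0) and "leapfrogging vortex rings" (10, physics),
`lit read` of arXiv:1610.09464 (Thm 1.1, Thm 1.3, Rmk 1.2/1.4, §3 indirect argument pp. chunk 8–9),
arXiv:1904.02387 (chunks 3,5,7,8: time-dependent Euler–Leray equation, circulation/energy
compatibility for EULER self-similar solutions), arXiv:1903.11699 (CLV: steady only),
arXiv:2603.21644 (abstract); the card's own audit (refuter-novelty-audit-5: Pomeau2017,
GinibreLeberrePomeau2019, Chae2007, ChaeTsai2014, Chae2023) and all 117 idea cards / 8 route files
of the summit.
Nearest prior art: Pomeau2017 + GinibreLeberrePomeau2019 (large-Re self-similar singularity as an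
Euler(–Leray) object, viscosity perturbative, Euler invariants — energy vs Kelvin circulation — as
selection/compatibility conditions; the drift ½(1 + y·∇) is kept at LEADING order, ν = 0, continuous
self-similarity); ChaeWolf2017RemovingDSS Thm 1.3 (removal of λ-DSS for 1 < λ < λ_*(C_*) by
compactness at fixed C_* + Tsai1998 — the route is preci  [refs: 2601.03161, 2603.12497, 2601.03833, 1610.09464, 1904.02387, 1903.11699, 2603.21644, Pomeau2017, GinibreLeberrePomeau2019, Chae2007, ChaeTsai2014, Chae2023, Tsai1998, ChaeWolf2023, GuckenheimerHolmes1983, GarciaHassainiaHmidi2026]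

Barriers (technique_class: melnikov-selection-off-euler blowup-construction): BARRIERS (catalogue Literature/Barriers/NavierStokesRegularity read 2026-08-15; technique_class:
melnikov-selection-off-euler blowup-construction).
- Literature.Barriers.NavierStokesRegularity.LeraySelfSimilarBlowupExclusion (necas_ruzicka_sverak,
tsai_selfsimilar, tsai_selfsimilar_local_energy): applies to EXACTLY self-similar (λ-continuous,
steady-in-s) profiles and is respected, indeed used: it is why every STEADY Euler seed is excluded
(Tsai's theorem is the ε → 0 shadow of 'persistence fails for steady W₀') and why PeriodicEulerSeed
demands genuine time dependence; the route's objects are s-PERIODIC orbits (λ-DSS / rotated DSS)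
with λ → 1⁺ AND C_* → ∞ simultaneously — outside Chae–Wolf's fixed-C_* window
(ChaeWolf2017RemovingDSS Thm 1.3), which is the barrier's recorded evasion.
- Literature.Barriers.NavierStokesRegularity.CriticalNormBlowupNecessity (ess_endpoint,
seregin_L3_blowup, tao_L3_blowup_rate): respected — a Type-I DSS profile has |u| ~ C/|x| at t = 0,
weak-L³ but not L³ (an L³ DSS profile is regular by ESS, ChaeWolf2017RemovingDSS Rmk 1.2), so
‖u(t)‖_{L³} of the truncated blow-up diverges; no L³-bounded ansatz is used.
- Literature.Barriers.NavierStokesRegularity.AxisymmetricTypeIExclusion (SereginSverak2009; in-tree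
knss_no_axisymmetric_typeI): evaded by construction and re-derived — axisymmetric seeds are killed
by the Casimir selection rules (transported ω_θ/r, vol{ru_θ > c} have nonzero scaling degree), and
PeriodicEulerSeed carries 'no axis of rotational

Novelty grade: new-combination — ROUTE REVIEW + grade (refuter route-review, 2026-08-15; full review attached as evidence on stmt-1413/1419). Grade new-combination: the (amplitude, time) rescaling W = U(·,σ/C_*)/C_* of Leray's backward similarity equation, turning a Type-I λ-(R)DSS profile of large temporal constant into 'incompres (refuter refuter-rreview-route-QuantumAdvantage-M-4fd66191-0, 2026-08-15T12:20:51Z; prior: ChaeWolf2017RemovingDSS arXiv:1610.09464 Thms 1.1, 1.3, Rmk 1.4, Pomeau2017, GinibreLeberrePomeau2019, Tsai1998 / Tsai2018 Conj 8.8-8.9, BradshawTsai2017CPDE Open Problem 5.1, GuckenheimerHolmes1983 ch.4 (Melnikov/averaging), FriedlanderVishik1991 / Vishik1996 (essential spectrum of linearised Euler), GarciaHassainiaHmidi2026 (time-periodic leapfrogging rings), Gavrilov2019 / ConstantinLaVicol2019)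

History (route lifecycle, newest last):
- 2026-08-15T16:13:07Z · rev 3: restated Assembly (stmt-NavierStokesRegularity-1420) — route-repair (glue): deciding theorem closes (hF : FastBranchProfiles) (hB : DssTruncationBridge) (hU : ClayUniqueness) : ¬ _root_.NavierStokesRegularity — self (planner-rbadge-NavierStokesRegularity-EulerMel-cbbae676-g2-0)
- 2026-08-15T16:16:36Z · rev 4: restated Assembly (stmt-NavierStokesRegularity-10366) — route-repair (staffability): rev 3 left deps.unproved = [Literature.Analysis.FluidPDE.TypeIDSSLiouvilleConjecture: undeclared-conjecture] — the conjecture const (planner-rbadge-NavierStokesRegularity-EulerMel-cbbae676-g2-0)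
- 2026-08-15T16:16:36Z · rev 4: dropped DssTruncationBridge — route-repair (staffability): rev 3 left deps.unproved = [Literature.Analysis.FluidPDE.TypeIDSSLiouvilleConjecture: undeclared-conjecture] — the conjecture const (planner-rbadge-NavierStokesRegularity-EulerMel-cbbae676-g2-0)
- 2026-08-15T22:11:57Z · rev 6: restated FiniteMelnikovCokernel (stmt-NavierStokesRegularity-1467) — repair stmt-1467 FiniteMelnikovCokernel (refuted-misstated by NOTE of refuter-rattack-stmt-NavierStokesRegularity-1467-0, item open, no signature): typed over t (planner-rrefute-NavierStokesRegularity-EulerMe-66cf4760-0)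
- 2026-08-16T02:17:28Z · AUTO-CRUX: 1 conjecture-grade item(s) promoted to crux (LargeAmplitudeDssLiouville) — refuter vetting / tiering apply (operator:999:1362873)
- 2026-08-22T13:01:57Z · DORMANT — reconciler: no traction for 5.3 d (last activity statement-grounded at 2026-08-17T04:05:30Z); parked, not closed — `ledger route dormant route-NavierStokesRegul (operator:999:3496780)
- 2026-08-27T05:12:15Z · REACTIVATED — reconciler: reactivated — activity item-proof-filed at 2026-08-27T03:54:11Z after parking at 2026-08-22T13:01:57Z (operator:999:1296265)
- 2026-09-01T21:29:12Z · DORMANT — reconciler: no traction for 5 d (last activity item-evidence-added at 2026-08-27T20:35:08Z); parked, not closed — `ledger route dormant route-NavierStokesRegula (operator:999:2703447)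

sub-problem: NavierStokesRegularity · status: dormant · opened planner-plancard-NavierStokesRegularity-Navie-af82cdc6-0 2026-08-15T10:55:45Z · rev 8 · ledger route-NavierStokesRegularity-EulerMelnikovDss
GENERATED by the gate from the ledger (D-0016/17). Provers cite these decls: `theorem foo : Summit.NavierStokesRegularity.NavierStokesRegularity.Theses.EulerMelnikovDss.<Decl> := …` in Summits/NavierStokesRegularity/NavierStokesRegularity/Theorems/<Name>.lean.
-/

namespace Summit.NavierStokesRegularity.NavierStokesRegularity.Theses.EulerMelnikovDss

open scoped BigOperators Topology Manifold Classical MeasureTheory ProbabilityTheory Matrix InnerProductSpace ComplexConjugate ContinuousMap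
open Filter Set Function TopologicalSpace MeasureTheory

attribute [summit_statement] _root_.NavierStokesRegularity

open Literature.NS

/-- item stmt-NavierStokesRegularity-1413 · target · rank 0 · open · by planner
why it might fail: The O(ε) solvability conditions for a PERIODIC Euler seed may be infinitely many (essential spectrum of linearised Euler: FriedlanderVishik1991, Vishik1996) and generically unsatisfiable; no admissible seed may exist; λ_* may be uniform in C_* (UniformDssRemovalNearOne).
sources: ChaeWolf2017RemovingDSS, Tsai2018, GuckenheimerHolmes1983, FriedlanderVishik1991, Vishik1996, Pomeau2017
[target] X = BIFURCATION FROM A PERIODIC EULER FLOW AT C_* = ∞: a smooth finite-energy classical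
Euler flow W on ℝ×ℝ³, P-periodic modulo an isometry Q and genuinely time-dependent, and Type-I
rotated-λ_n-DSS ancient mild solutions u_n (ν = 1, measurable slices, Type-I decay) with λ_n → 1⁺
and temporal constants C_n → ∞ whose (amplitude,time)-rescaled profiles W_n(σ,y) = C_n⁻¹ e^{−s/2}
u_n(−e^{−s}, e^{−s/2}y), s = σ/C_n, converge locally uniformly to W. Implies FastBranchProfiles (a
tail of the sequence). Card large-constant-euler-melnikov, fast branch (F): in W-variables the
profile equation is EXACTLY ∂_σW + W·∇W + ∇Π = ε(ΔW − ½(W + y·∇W)), ε = 1/C_*, period 2C_* log λ.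
[sources: ChaeWolf2017RemovingDSS Thm 1.3 and §3, Tsai2018 Conj 8.8-8.9, GuckenheimerHolmes1983 ch
4, Pomeau2017, GinibreLeberrePomeau2019] -/
@[route_item "route-NavierStokesRegularity-EulerMelnikovDss"]
def Target : Prop :=
  ∃ (W : ℝ → EuclideanSpace ℝ (Fin 3) → EuclideanSpace ℝ (Fin 3)) (q : ℝ → EuclideanSpace ℝ (Fin 3) → ℝ) (P : ℝ) (Q : EuclideanSpace ℝ (Fin 3) ≃ₗᵢ[ℝ] EuclideanSpace ℝ (Fin 3)), 0 < P ∧ Literature.Analysis.FluidPDE.IsClassicalEulerSolutionOn Set.univ 0 W q ∧ (∀ σ y, W (σ + P) (Q y) = Q (W σ y)) ∧ (∃ σ y, W σ y ≠ W 0 y) ∧ ∃ (c C : ℕ → ℝ) (R : ℕ → (EuclideanSpace ℝ (Fin 3) ≃ₗᵢ[ℝ] EuclideanSpace ℝ (Fin 3))) (u : ℕ → ℝ → EuclideanSpace ℝ (Fin 3) → EuclideanSpace ℝ (Fin 3)), (∀ n, 1 < c n) ∧ Tendsto c atTop (𝓝 1) ∧ (∀ n, 0 < C n) ∧ Tendsto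 C atTop atTop ∧ (∀ n, Literature.Analysis.FluidPDE.IsAncientMildSolution 1 (u n) ∧ (∀ t < 0, AEStronglyMeasurable (u n t) volume) ∧ Literature.Analysis.FluidPDE.IsRotatedDSS (c n) (R n) (u n) ∧ (∃ C₀ : ℝ, Literature.Analysis.FluidPDE.HasTypeIDecay C₀ (u n)) ∧ (∀ t < 0, ∀ x, Real.sqrt (-t) * ‖u n t x‖ ≤ C n)) ∧ TendstoLocallyUniformly (fun n (z : ℝ × EuclideanSpace ℝ (Fin 3)) => (C n)⁻¹ • (Real.exp (-(z.1 / C n) / 2) • u n (-Real.exp (-(z.1 / C n))) (Real.exp (-(z.1 / C n) / 2) • z.2))) (uncurry W) atTop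

/-- item stmt-NavierStokesRegularity-1414 · crux · rank 2 · open · by planner
why it might fail: λ_* may be uniform in C_* (a quantitative Chae–Wolf bound log λ_*(C) ≫ 1/C kills the branch); the Melnikov cokernel of a periodic Euler seed is plausibly infinite (essential spectrum), so persistence may fail as it does for every STEADY seed (Tsai1998).
sources: ChaeWolf2017RemovingDSS, Tsai1998, Tsai2018, BradshawTsai2017CPDE, GuckenheimerHolmes1983, FriedlanderVishik1991
[crux] FAST BRANCH: for every δ > 0 there are λ ∈ (1, 1+δ) and R ∈ O(3) admitting a nontrivial
Type-I rotated-λ-DSS ancient mild solution (¬RotatedTypeIDSSLiouville λ R). Mechanism: an admissible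
periodic Euler seed W₀ (PeriodicEulerSeed) with finite Melnikov cokernel (FiniteMelnikovCokernel)
persists to ε = 1/C_* > 0 as a (2C_* log λ)-periodic solution of ∂_σW + W·∇W + ∇Π = ε(ΔW − ½(W +
y·∇W)) with Type-I tail, λ = exp(P₀ε/2)(1+o(1)) → 1⁺; by ChaeWolf2017RemovingDSS Thm 1.3 such
profiles necessarily have C_* → ∞ (the route is the failure mode of Chae–Wolf's fixed-C_*
compactness, arXiv:1610.09464 §3). Consumed by the assembly (δ := 1 ⇒ ¬TypeIDSSLiouvilleConjecture).
Its negation is UniformDssRemovalNearOne (equivalence proved in the planner's Sketch.lean). Foreseen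
layer-2 split: seed / linear solvability / nonlinear persistence with tail matching at O(ε).
[sources: ChaeWolf2017RemovingDSS, Tsai1998, Tsai2018, BradshawTsai2017CPDE Open Problem 5.1,
GuckenheimerHolmes1983, FriedlanderVishik1991] -/
@[route_item "route-NavierStokesRegularity-EulerMelnikovDss", crux]
def FastBranchProfiles : Prop :=
  ∀ δ : ℝ, 0 < δ → ∃ c : ℝ, 1 < c ∧ c < 1 + δ ∧ ∃ R : EuclideanSpace ℝ (Fin 3) ≃ₗᵢ[ℝ] EuclideanSpace ℝ (Fin 3), ¬ Literature.Analysis.FluidPDE.RotatedTypeIDSSLiouville c R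

-- earlier FiniteMelnikovCokernel (stmt-NavierStokesRegularity-1467, replaced 2026-08-15T22:11:57Z -> stmt-NavierStokesRegularity-13890): retired by None — [crux] (rank 3; informal until the monodromy/Floquet notion for the rescaled Euler–Leray system is defined — definition request filed; same operator family as route DssFarFieldSlaving's requested IsHyperbolicTypeIDSSOrbit) FINITE MELNIKOV COKERNEL
/-- item stmt-NavierStokesRegularity-13890 · crux · rank 3 · open · by planner
why it might fail: 1 lies in the inviscid essential spectrum (FriedlanderVishik1991, Vishik1996); as ε→0⁺ viscous eigenvalues may accumulate within O(ε) of 1 outside the far-field disc (Orr–Sommerfeld branches, Drazin2002), or seeds come in infinite families (relative equilibria, resonant Kelvin modes): no bound m.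
sources: FriedlanderVishik1991, Vishik1996, Shvydkoy2006, Kato1966, Kielhofer2012, GuckenheimerHolmes1983
[crux] FINITE MELNIKOV COKERNEL — repaired statement C″ (planner route-repair after
refuter-rattack-1467-0, verdict refuted-misstated; evidence CRUX-ATTACK-1467.md v2 / Toy.lean v2 /
Typing.lean on stmt-NavierStokesRegularity-1467). For every ADMISSIBLE SEED (W₀,q₀,P₀,Q) —
hypotheses = the clauses of PeriodicEulerSeed verbatim — let M_ε be the period-P₀ monodromy, twisted
by Q, of the rescaled Euler–Leray system linearised at W₀ (L_ε v = ∂_σv + P[W₀·∇v + v·∇W₀] − ε(Δv −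
½(v + y·∇v))), in VORTICITY form on the FLAT solenoidal space L²_σ(ℝ³,dy) [M1:
`IsRescaledEulerLerayMonodromy ε W₀ P₀ Q`, w = 1; not the Gaussian space of the old wording, which
carries no bounded period map]. CLAIM: for every C > 0 there are m ∈ ℕ, ε₁ > 0 such that for all ε ∈
(0,ε₁): (i) a UNIQUE such monodromy exists (parabolic well-posedness + uniqueness of weak solutions
in the class IsLinearisedVorticitySolution + density of classical data,
`IsLinearisedMonodromyAt.unique_of_dense` — a recorded obligation; energy estimate gives ‖M_ε‖ ≤
e^{c(W₀)P₀} uniformly in ε); (ii) for some C' ∈ [C,2C], θ ∈ [1/16,1/8] the boundary of the SCALE-ε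
WINDOW R_ε = {|z−1| < C'ε} ∩ {|z| > e^{−εP₀θ}} lies in the resolvent set of M_ -/
@[route_item "route-NavierStokesRegularity-EulerMelnikovDss"]
def FiniteMelnikovCokernel : Prop :=
  ∀ (W : ℝ → EuclideanSpace ℝ (Fin 3) → EuclideanSpace ℝ (Fin 3)) (q : ℝ → EuclideanSpace ℝ (Fin 3) → ℝ) (P : ℝ) (Q : EuclideanSpace ℝ (Fin 3) ≃ₗᵢ[ℝ] EuclideanSpace ℝ (Fin 3)), 0 < P → Literature.Analysis.FluidPDE.IsClassicalEulerSolutionOn Set.univ 0 W q → (∀ σ y, W (σ + P) (Q y) = Q (W σ y)) → (∃ σ y, W σ y ≠ W 0 y) → (∀ σ, MemLp (W σ) 2 volume) → (∀ k : ℕ, ∃ A : ℝ, ∀ σ y, ‖y‖ ^ k * ‖Literature.Analysis.FluidPDE.curl (W σ) y‖ ≤ A) → (∀ σ, ∫ y, Literature.Analysis.FluidPDE.cross y (Literature.Analysis.FluidPDE.curl (W σ) y) = 0) → (∀ σ, ∫ y, (‖y‖ ^ 2) • Literature.Analysis.FluidPDE.curl (W σ) y = 0) → (∫ σ in (0:ℝ)..P,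 ∫ y, inner ℝ (Literature.Analysis.FluidPDE.curl (W σ) y) (Literature.Analysis.FluidPDE.curl (Literature.Analysis.FluidPDE.curl (W σ)) y) = 0) → (∀ (R : EuclideanSpace ℝ (Fin 3) ≃ₗᵢ[ℝ] EuclideanSpace ℝ (Fin 3)) (a : EuclideanSpace ℝ (Fin 3)), ¬ ∀ σ, Literature.Analysis.FluidPDE.IsAxisymmetric (fun y => R.symm (W σ (R y + a)))) → ∀ C : ℝ, 0 < C → ∃ (m : ℕ) (ε₁ : ℝ), 0 < ε₁ ∧ ∀ ε ∈ Set.Ioo (0:ℝ) ε₁, ∃ M : MeasureTheory.Lp (EuclideanSpace ℝ (Fin 3)) 2 (Literature.Analysis.FluidPDE.weightedMeasure (1 : EuclideanSpace ℝ (Fin 3) → NNReal)) →L[ℝ] MeasureTheory.Lp (EuclideanSpace ℝ (Fin 3)) 2 (Literature.Analysis.FluidPDE.weightedMeasure (1 : EuclideanSpace ℝ (Fin 3) → NNReal)), Literature.Analysis.FluidPDE.IsRescaledEulerLerayMonodromy ε W P Q M ∧ (∀ M', Literature.Analysis.FluidPDE.IsRescaledEulerLerayMonodromy ε W P Q M'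 → M' = M) ∧ ∃ (C' θ : ℝ), C ≤ C' ∧ C' ≤ 2 * C ∧ 1 / 16 ≤ θ ∧ θ ≤ 1 / 8 ∧ ∃ N S : Submodule ℝ (MeasureTheory.Lp (EuclideanSpace ℝ (Fin 3)) 2 (Literature.Analysis.FluidPDE.weightedMeasure (1 : EuclideanSpace ℝ (Fin 3) → NNReal))), IsCompl N S ∧ IsClosed (S : Set (MeasureTheory.Lp (EuclideanSpace ℝ (Fin 3)) 2 (Literature.Analysis.FluidPDE.weightedMeasure (1 : EuclideanSpace ℝ (Fin 3) → NNReal)))) ∧ FiniteDimensional ℝ N ∧ Module.finrank ℝ N ≤ m ∧ (∀ x ∈ N, M x ∈ N) ∧ (∀ x ∈ S, M x ∈ S) ∧ (∀ a b : ℝ, (a - 1) ^ 2 + b ^ 2 ≤ (C' * ε) ^ 2 → Real.exp (-(2 * (ε * P * θ))) ≤ a ^ 2 + b ^ 2 → Set.BijOn (fun x => M (M x) - (2 * a) • M x + (a ^ 2 + b ^ 2) • x) S S) ∧ (∀ a b : ℝ, ((C' * ε) ^ 2 ≤ (a - 1) ^ 2 + b ^ 2 ∨ a ^ 2 + b ^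 2 ≤ Real.exp (-(2 * (ε * P * θ)))) → Set.InjOn (fun x => M (M x) - (2 * a) • M x + (a ^ 2 + b ^ 2) • x) N)

/-- item stmt-NavierStokesRegularity-1415 · crux · rank 4 · open · by planner
why it might fail: No finite-energy, genuinely time-dependent, time-periodic smooth Euler flow on ℝ³ is known (Gavrilov2019/ConstantinLaVicol2019: steady; GarciaHassainiaHmidi2026: axisymmetric, translating frame); admissible seeds may not exist, or only as relative equilibria killed by RSS-type Liouville theorems.
sources: GarciaHassainiaHmidi2026, Gavrilov2019, ConstantinLaVicol2019, KNSS2009, SereginSverak2009, MajdaBertozzi2002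
[crux] ADMISSIBLE SEED: there is a smooth classical Euler solution (W, q) on ℝ×ℝ³, P-periodic modulo
an isometry Q (W(σ+P)(Qy) = Q·W(σ)(y)), genuinely time-dependent, of finite energy, with vorticity
rapidly decaying uniformly in σ, zero impulse ∫ y × curl W = 0, zero angular impulse ∫ |y|² curl W =
0, zero mean helicity dissipation ∫₀^P ∫ ⟨curl W, curl curl W⟩ = 0, and NO axis of rotational
symmetry (for every isometry R and centre a the conjugated slices are not all axisymmetric). These
are the leading-order selection rules the exact moment laws (PeriodMomentLaws) force on the Euler
limit of fast-branch profiles (I ≡ 0 from dI/dσ = εI, A ≡ 0 from dA/dσ = (3ε/2)A — also for rotated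
DSS —, helicity law), plus the Casimir obstructions that exclude axisymmetric seeds (transported
ω_θ/r and superlevel volumes of ru_θ have nonzero scaling degree; reproduces KNSS2009 Thm 5.2 /
SereginSverak2009). Candidates: non-axisymmetric relative equilibria (rotation absorbed by rotated
DSS), Kelvin-wave structures with zero net impulse, vorton/quadrupole configurations; technology:
the degenerate KAM / Nash–Moser scheme of GarciaHassainiaHmidi2026 (whose leapfrogging rings are
axisymmetric and peri -/
@[route_item "route-NavierStokesRegularity-EulerMelnikovDss"]
def PeriodicEulerSeed : Prop :=
  ∃ (W : ℝ → EuclideanSpace ℝ (Fin 3) → EuclideanSpace ℝ (Fin 3)) (q : ℝ → EuclideanSpace ℝ (Fin 3) → ℝ) (P : ℝ) (Q : EuclideanSpace ℝ (Fin 3) ≃ₗᵢ[ℝ] EuclideanSpace ℝ (Fin 3)), 0 < P ∧ Literature.Analysis.FluidPDE.IsClassicalEulerSolutionOn Set.univ 0 W q ∧ (∀ σ y, W (σ + P) (Q y) = Q (W σ y)) ∧ (∃ σ y, W σ y ≠ W 0 y) ∧ (∀ σ, MemLp (W σ) 2 volume) ∧ (∀ k : ℕ, ∃ A : ℝ, ∀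 σ y, ‖y‖ ^ k * ‖Literature.Analysis.FluidPDE.curl (W σ) y‖ ≤ A) ∧ (∀ σ, ∫ y, Literature.Analysis.FluidPDE.cross y (Literature.Analysis.FluidPDE.curl (W σ) y) = 0) ∧ (∀ σ, ∫ y, (‖y‖ ^ 2) • Literature.Analysis.FluidPDE.curl (W σ) y = 0) ∧ (∫ σ in (0:ℝ)..P, ∫ y, inner ℝ (Literature.Analysis.FluidPDE.curl (W σ) y) (Literature.Analysis.FluidPDE.curl (Literature.Analysis.FluidPDE.curl (W σ)) y) = 0) ∧ (∀ (R : EuclideanSpace ℝ (Fin 3) ≃ₗᵢ[ℝ] EuclideanSpace ℝ (Fin 3)) (a : EuclideanSpace ℝ (Fin 3)), ¬ ∀ σ, Literature.Analysis.FluidPDE.IsAxisymmetric (fun y => R.symm (W σ (R y + a))))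

/-- item stmt-NavierStokesRegularity-1416 · crux · rank 5 · open · by planner
why it might fail: At Reynolds number 1/ε → ∞ nothing known prevents unit-amplitude ancient DSS profiles from carrying gradients ~ 1/ε (anomalous dissipation, turbulent profiles); the only a-priori bound is quadratic in C (KNSS2009 §2-3, ChaeWolf2017RemovingDSS Thm 1.1).
sources: KNSS2009, ChaeWolf2017RemovingDSS, DuchonRobert2000, BradshawPhelps2023
[crux] UNIT-AMPLITUDE GRADIENT BOUND (strong Euler limit): there is a universal K such that every
ancient mild solution (ν = 1, measurable slices) that is rotated λ-DSS (λ > 1, R ∈ O(3)) with Type-I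
decay and √(−t)|u| ≤ C has a C¹ representative with (−t)|∇u| ≤ K(1 + C). In rescaled variables |∇_y
W| ≤ K uniformly in ε = 1/C: large-constant profiles are LAMINAR at unit amplitude, so sequences
with C_n → ∞ have Lipschitz-compact Euler limits — what makes 'large-constant profile = weakly
perturbed Euler flow' a theorem rather than an ansatz, and what the positive endpoint
LargeAmplitudeDssLiouville needs. Known: parabolic regularity of bounded ancient solutions gives
only (−t)|∇u| ≲ C² (KNSS2009 §2-3; ChaeWolf2017RemovingDSS Thm 1.1), and Chae–Wolf's indirect
argument (arXiv:1610.09464 §3) is compactness at FIXED C. [sources: KNSS2009,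
ChaeWolf2017RemovingDSS, DuchonRobert2000, BradshawPhelps2023] -/
@[route_item "route-NavierStokesRegularity-EulerMelnikovDss"]
def StrongEulerLimit : Prop :=
  ∃ K : ℝ, ∀ (c C : ℝ) (R : EuclideanSpace ℝ (Fin 3) ≃ₗᵢ[ℝ] EuclideanSpace ℝ (Fin 3)) (u : ℝ → EuclideanSpace ℝ (Fin 3) → EuclideanSpace ℝ (Fin 3)), 1 < c → Literature.Analysis.FluidPDE.IsAncientMildSolution 1 u → (∀ t < 0, AEStronglyMeasurable (u t) volume) → Literature.Analysis.FluidPDE.IsRotatedDSS c R u → (∃ C₀ : ℝ, Literature.Analysis.FluidPDE.HasTypeIDecay C₀ u) → (∀ t < 0, ∀ x, Real.sqrt (-t) * ‖u t x‖ ≤ C) → ∃ v : ℝ → EuclideanSpace ℝ (Fin 3) → EuclideanSpace ℝ (Fin 3), (∀ t < 0, v t =ᵐ[volume] u t) ∧ (∀ t < 0, ContDiff ℝ 1 (v t)) ∧ ∀ t < 0, ∀ x, (-t) * ‖fderiv ℝ (v t) x‖ ≤ K * (1 + C)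

/-- item stmt-NavierStokesRegularity-1418 · crux (kind.auto-crux: conjecture-grade) · rank 7 · open · by planner
why it might fail: auto-crux — conjecture-grade statement (docstring avows it ('conjecture')); it is open, so it may simply be false
sources: ChaeWolf2017RemovingDSS, Tsai2018, KNSS2009, SereginSverak2009
[support] POSITIVE ENDPOINT X_D⁺ (large-amplitude half of Tsai's conjecture): there is a universal
C₁ such that every NONTRIVIAL Type-I rotated-λ-DSS ancient mild solution (any λ > 1, any R, ν = 1,
measurable slices) satisfies √(−t)|u| ≤ C₁ a.e. on every slice — no profiles of large Type-I
constant. The card's positive reading: StrongEulerLimit ⇒ large-constant profiles are weakly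
perturbed Euler flows ⇒ the fast branch is excluded by an infinite Melnikov cokernel / a
quantitative λ_*(C), the slow branch (log λ = O(1)) by gradient-likeness of the averaged drift q̇ =
Π_{Tℳ}𝓛W₀(q) on steady-Euler families (viscous core fattening is monotone, scaling drift preserves
shape ratios). With small-constant triviality (ChaeWolf2017RemovingDSS Rmk 1.4) it confines Tsai's
conjecture to a compact amplitude window — hand-off to card type-i-certificate-ladder; informative
for route TypeILiouville. Independent of this route's negative assembly. [sources:
ChaeWolf2017RemovingDSS, Tsai2018, KNSS2009, SereginSverak2009] -/
@[route_item "route-NavierStokesRegularity-EulerMelnikovDss"]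
def LargeAmplitudeDssLiouville : Prop :=
  ∃ C₁ : ℝ, ∀ (c : ℝ) (R : EuclideanSpace ℝ (Fin 3) ≃ₗᵢ[ℝ] EuclideanSpace ℝ (Fin 3)) (u : ℝ → EuclideanSpace ℝ (Fin 3) → EuclideanSpace ℝ (Fin 3)), 1 < c → Literature.Analysis.FluidPDE.IsAncientMildSolution 1 u → (∀ t < 0, AEStronglyMeasurable (u t) volume) → Literature.Analysis.FluidPDE.IsRotatedDSS c R u → (∃ C₀ : ℝ, Literature.Analysis.FluidPDE.HasTypeIDecay C₀ u) → (¬ ∀ t < 0, u t =ᵐ[volume] 0) → ∀ t < 0, ∀ᵐ x ∂volume, Real.sqrt (-t) * ‖u t x‖ ≤ C₁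

/-- item stmt-NavierStokesRegularity-18953 · crux · rank 8 · open · by planner
why it might fail: Even with a finite near-1 cluster the reduced bifurcation map on N may have no zero (Melnikov numbers beyond the E,I,A,H directions; symmetry degeneracies), matching the finite-energy seed to the compulsory |y|⁻¹ Type-I tail at O(ε) may fail, and Nash–Moser losses of the Euler part may not close.
sources: GuckenheimerHolmes1983, Kielhofer2012, ChaeWolf2017RemovingDSS, BradshawPhelps2023, GarciaHassainiaHmidi2026, BradshawTsai2017CPDE
[crux] NONLINEAR PERSISTENCE ALONG THE FAST BRANCH (piece 3 of the BC2 decomposition of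
FastBranchProfiles; planner crux-strategist 2026-08-17). For every ADMISSIBLE SEED (W,q,P,Q) —
hypotheses = the clauses of PeriodicEulerSeed verbatim — whose ε-monodromies carry the FINITE NEAR-1
FLOQUET CLUSTER (the conclusion of FiniteMelnikovCokernel for this seed, verbatim, as hypothesis),
the seed persists as Type-I rotated-DSS profiles along the fast branch: there are amplitudes C n →
∞, periods P' n → P, isometries R n and fields u n with u n an ancient mild solution (ν = 1,
measurable slices), rotated-DSS with the DERIVED factor λ n = exp(P' n/(2 C n)) and isometry R n,
Type-I decay, √(−t)|u n| ≤ C n, NONTRIVIAL (slices not a.e. zero), and rescaled profiles W n(σ,y) =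
(C n)⁻¹ e^{−s/2} u n(−e^{−s}, e^{−s/2} y), s = σ/C n, converging locally uniformly to W (Target's
formula). Mechanism: Lyapunov–Schmidt / Nash–Moser continuation in ε = 1/C of the P-periodic-mod-Q
orbit W of the rescaled Euler–Leray system ∂_σW + W·∇W + ∇Π = ε(ΔW − ½(W + y·∇W)) off ε = 0; the
reduced equation lives on the finite cluster (dim ≤ m), where the seed's selection rules (I = A = 0,
zero mean helicity dissipation) -/
@[route_item "route-NavierStokesRegularity-EulerMelnikovDss"]
def NonlinearPersistence : Prop :=
  ∀ (W : ℝ → EuclideanSpace ℝ (Fin 3) → EuclideanSpace ℝ (Fin 3)) (q : ℝ → EuclideanSpace ℝ (Fin 3) → ℝ) (P : ℝ) (Q : EuclideanSpace ℝ (Fin 3) ≃ₗᵢ[ℝ] EuclideanSpace ℝ (Fin 3)), 0 < P → Literature.Analysis.FluidPDE.IsClassicalEulerSolutionOn Set.univ 0 W q → (∀ σ y, W (σ + P) (Q y) = Q (W σ y)) → (∃ σ y, W σ y ≠ W 0 y) → (∀ σ, MemLp (W σ) 2 volume) → (∀ k : ℕ, ∃ A : ℝ, ∀ σ y, ‖y‖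 ^ k * ‖Literature.Analysis.FluidPDE.curl (W σ) y‖ ≤ A) → (∀ σ, ∫ y, Literature.Analysis.FluidPDE.cross y (Literature.Analysis.FluidPDE.curl (W σ) y) = 0) → (∀ σ, ∫ y, (‖y‖ ^ 2) • Literature.Analysis.FluidPDE.curl (W σ) y = 0) → (∫ σ in (0:ℝ)..P, ∫ y, inner ℝ (Literature.Analysis.FluidPDE.curl (W σ) y) (Literature.Analysis.FluidPDE.curl (Literature.Analysis.FluidPDE.curl (W σ)) y) = 0) → (∀ (R : EuclideanSpace ℝ (Fin 3) ≃ₗᵢ[ℝ] EuclideanSpace ℝ (Fin 3)) (a : EuclideanSpace ℝ (Fin 3)), ¬ ∀ σ, Literature.Analysis.FluidPDE.IsAxisymmetric (fun y => R.symm (W σ (R y + a)))) → (∀ C : ℝ, 0 < C → ∃ (m : ℕ) (ε₁ : ℝ), 0 < ε₁ ∧ ∀ ε ∈ Set.Ioo (0:ℝ) ε₁, ∃ M : MeasureTheory.Lp (EuclideanSpace ℝ (Fin 3)) 2 (Literature.Analysis.FluidPDE.weightedMeasure (1 : EuclideanSpace ℝ (Fin 3) → NNReal)) →L[ℝ] MeasureTheory.Lp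 (EuclideanSpace ℝ (Fin 3)) 2 (Literature.Analysis.FluidPDE.weightedMeasure (1 : EuclideanSpace ℝ (Fin 3) → NNReal)), Literature.Analysis.FluidPDE.IsRescaledEulerLerayMonodromy ε W P Q M ∧ (∀ M', Literature.Analysis.FluidPDE.IsRescaledEulerLerayMonodromy ε W P Q M' → M' = M) ∧ ∃ (C' θ : ℝ), C ≤ C' ∧ C' ≤ 2 * C ∧ 1 / 16 ≤ θ ∧ θ ≤ 1 / 8 ∧ ∃ N S : Submodule ℝ (MeasureTheory.Lp (EuclideanSpace ℝ (Fin 3)) 2 (Literature.Analysis.FluidPDE.weightedMeasure (1 : EuclideanSpace ℝ (Fin 3) → NNReal))), IsCompl N S ∧ IsClosed (S : Set (MeasureTheory.Lp (EuclideanSpace ℝ (Fin 3)) 2 (Literature.Analysis.FluidPDE.weightedMeasure (1 : EuclideanSpace ℝ (Fin 3) → NNReal)))) ∧ FiniteDimensional ℝ N ∧ Module.finrank ℝ N ≤ m ∧ (∀ x ∈ N, M x ∈ N) ∧ (∀ x ∈ S, M x ∈ S) ∧ (∀ a b : ℝ, (a - 1) ^ 2 + b ^ 2 ≤ (C' * ε)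 ^ 2 → Real.exp (-(2 * (ε * P * θ))) ≤ a ^ 2 + b ^ 2 → Set.BijOn (fun x => M (M x) - (2 * a) • M x + (a ^ 2 + b ^ 2) • x) S S) ∧ (∀ a b : ℝ, ((C' * ε) ^ 2 ≤ (a - 1) ^ 2 + b ^ 2 ∨ a ^ 2 + b ^ 2 ≤ Real.exp (-(2 * (ε * P * θ)))) → Set.InjOn (fun x => M (M x) - (2 * a) • M x + (a ^ 2 + b ^ 2) • x) N)) → ∃ (K : ℝ) (C P' : ℕ → ℝ) (R : ℕ → (EuclideanSpace ℝ (Fin 3) ≃ₗᵢ[ℝ] EuclideanSpace ℝ (Fin 3))) (u : ℕ → ℝ → EuclideanSpace ℝ (Fin 3) → EuclideanSpace ℝ (Fin 3)), (∀ n, 0 < C n) ∧ Tendsto C atTop atTop ∧ Tendsto P' atTop (𝓝 P) ∧ (∀ n, Literature.Analysis.FluidPDE.IsAncientMildSolution 1 (u n) ∧ (∀ t < 0, AEStronglyMeasurable (u n t) volume) ∧ Literature.Analysis.FluidPDE.IsRotatedDSS (Real.exp (P' n / (2 * C n))) (R n) (u n) ∧ (∃ C₀ : ℝ, Literature.Analysis.FluidPDE.HasTypeIDecay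 C₀ (u n)) ∧ (∀ t < 0, ∀ x, Real.sqrt (-t) * ‖u n t x‖ ≤ K * C n) ∧ ¬ (∀ t < 0, u n t =ᵐ[volume] 0)) ∧ TendstoLocallyUniformly (fun n (z : ℝ × EuclideanSpace ℝ (Fin 3)) => (C n)⁻¹ • (Real.exp (-(z.1 / C n) / 2) • u n (-Real.exp (-(z.1 / C n))) (Real.exp (-(z.1 / C n) / 2) • z.2))) (uncurry W) atTop

/-- item stmt-NavierStokesRegularity-1417 · support · rank 6 · open · by planner
sources: ChaeWolf2017RemovingDSS, Tsai1998, Tsai2018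
[support] KILL SWITCH = ¬FastBranchProfiles (equivalence proved in the planner's Sketch.lean): there
is λ₀ > 1 such that RotatedTypeIDSSLiouville λ R holds for all 1 < λ < λ₀ and all R ∈ O(3) —
Chae–Wolf's removal theorem (ChaeWolf2017RemovingDSS Thm 1.3) with λ_* INDEPENDENT of the Type-I
constant C_*. Routes to it: a quantitative form of the indirect argument of arXiv:1610.09464 §3
surviving C_* → ∞ (rescaled Euler picture: StrongEulerLimit + an Euler–Liouville theorem for
periodic limits meeting the selection rules), or the head-pressure / log-time bounds of cards
dss-head-pressure-dual-measure, bandlimited-logtime-dss-corner, efimov-quantised-dss-factor (λ_* − 1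
≳ ν/(C² log C) would NOT suffice; one needs λ_*(C) − 1 ≫ 1/C). Proving it refutes crux #2 and closes
the route refuted:FastBranchProfiles. [sources: ChaeWolf2017RemovingDSS Thm 1.3, Tsai1998, Tsai2018] -/
@[route_item "route-NavierStokesRegularity-EulerMelnikovDss"]
def UniformDssRemovalNearOne : Prop :=
  ∃ c₀ : ℝ, 1 < c₀ ∧ ∀ c : ℝ, 1 < c → c < c₀ → ∀ R : EuclideanSpace ℝ (Fin 3) ≃ₗᵢ[ℝ] EuclideanSpace ℝ (Fin 3), Literature.Analysis.FluidPDE.RotatedTypeIDSSLiouville c R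

/-- item stmt-NavierStokesRegularity-0153 · support · rank 9 · closed · proved by Summit.NavierStokesRegularity.NavierStokesRegularity.Theorems.adiabaticEddy_clayUniqueness_proof @ bd26efe366a2 (prover) · by planner
sources: Fefferman2000, Tao2011
Fefferman's class (A) = jointly C^∞ on ℝ³×[0,∞) + sup_t ∫|u|² < ∞; no energy inequality, no decay of
∇u, no integrability in LPS scales is assumed. Claim: such (u,p) coincides on [0,T) with any
Leray–Hopf classical solution v from the same rapidly decaying datum. Expected route: smoothness +
bounded energy ⇒ u is a distributional solution with locally finite dissipation?? (NOT automatic: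
∫∫|∇u|² may be infinite) — this is exactly the delicate point; alternatives: Liouville-type control
of the pressure (p harmonic part must be affine ⇒ excluded by bounded energy), then local energy
inequality, then weak–strong uniqueness (Prodi 1959, Serrin 1963) against v which is in every LPS
class on compacts of [0,T). [sources: Prodi1959, Serrin1963, Fefferman2000, LemarieRieusset2002,
RobinsonRodrigoSadowski2016] -/
@[route_item "route-NavierStokesRegularity-EulerMelnikovDss", crux]
def ClayUniqueness : Prop :=
  ∀ ν : ℝ, 0 < ν → ∀ (u₀ : EuclideanSpace ℝ (Fin 3) → EuclideanSpace ℝ (Fin 3)), Literature.Analysis.FluidPDE.HasRapidSpatialDecay u₀ → ∀ (u v : ℝ → EuclideanSpace ℝ (Fin 3) → EuclideanSpace ℝ (Fin 3)) (p q : ℝ → EuclideanSpace ℝ (Fin 3) → ℝ) (T : ℝ), 0 < T → Literature.Analysis.FluidPDE.IsSmoothOnHalfSpace u → Literature.Analysis.FluidPDE.IsSmoothOnHalfSpace p → Literature.Analysis.FluidPDE.IsNavierStokesSolution ν 0 u₀ u p → Literature.Analysis.FluidPDE.HasBoundedEnergy u → Literature.Analysis.FluidPDE.IsClassicalNSSolutionOn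 (Set.Ico 0 T) ν 0 v q → Literature.Analysis.FluidPDE.IsLerayHopfOn T ν 0 u₀ v → v 0 = u₀ → ∀ t ∈ Set.Ico 0 T, u t = v t

/-- `ClayUniqueness` holds: proved by `Summit.NavierStokesRegularity.NavierStokesRegularity.Theorems.adiabaticEddy_clayUniqueness_proof` @ bd26efe366a2. -/
theorem ClayUniqueness_holds : ClayUniqueness := _root_.Summit.NavierStokesRegularity.NavierStokesRegularity.Theorems.adiabaticEddy_clayUniqueness_proof

/-- item stmt-NavierStokesRegularity-10475 · support · rank 9 · closed · proved by Summit.NavierStokesRegularity.NavierStokesRegularity.Theorems.rotatedDssBlowupBridge_proof (prover) · by planner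
sources: JiaSverak2014, BradshawTsai2017CPDE, ChaeWolf2017RemovingDSS, Tsai2018
[support] TRUNCATION BRIDGE, ROTATED FORM — the same mathematical statement as
stmt-NavierStokesRegularity-0901 (DssTruncationBridge, route DssFarFieldSlaving:
¬TypeIDSSLiouvilleConjecture → X5a) with its antecedent unfolded through the accepted
`Literature.Analysis.FluidPDE.typeIDSSLiouvilleConjecture_iff` (¬TypeIDSSLiouvilleConjecture ↔ ∃ λ
R, ¬RotatedTypeIDSSLiouville λ R; equivalence of the two items checked in the planner's
Preview3.lean: `unfold; rw [typeIDSSLiouvilleConjecture_iff]; push_neg; rfl`, lean rc 0) — so a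
proof of either closes the other in three lines; PROVERS: file both. Statement: if for some factor λ
and some R ∈ O(3) there is a NONTRIVIAL Type-I rotated-λ-DSS ancient mild solution (ν = 1,
measurable slices, |u| ≤ C₀/(|x|+√−t)), then some rapidly decaying divergence-free datum has a
Leray–Hopf classical solution with finite maximal lifespan (IsMaximalSmoothSolution ∧ IsLerayHopfOn
∧ HasRapidSpatialDecay (u 0); any ν > 0 by scaling). Construction as in 0901 (similarity variables,
s-periodic orbit U_* of the Leray equation, Bogovskiĭ-corrected truncation χ_R u_*(·,T−1), the
outward drift ½y·∇ keeps the far-field error out of the backward paraboloid; JiaSverak201 -/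
@[route_item "route-NavierStokesRegularity-EulerMelnikovDss", crux]
def RotatedDssBlowupBridge : Prop :=
  (∃ (c : ℝ) (R : EuclideanSpace ℝ (Fin 3) ≃ₗᵢ[ℝ] EuclideanSpace ℝ (Fin 3)), ¬ Literature.Analysis.FluidPDE.RotatedTypeIDSSLiouville c R) → ∃ ν : ℝ, 0 < ν ∧ ∃ T : ℝ, 0 < T ∧ ∃ (u : ℝ → EuclideanSpace ℝ (Fin 3) → EuclideanSpace ℝ (Fin 3)) (p : ℝ → EuclideanSpace ℝ (Fin 3) → ℝ), Literature.Analysis.FluidPDE.IsMaximalSmoothSolution ν 0 u p T ∧ Literature.Analysis.FluidPDE.IsLerayHopfOn T ν 0 (u 0) u ∧ Literature.Analysis.FluidPDE.HasRapidSpatialDecay (u 0)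

-- `RotatedDssBlowupBridge` holds: proved by `Summit.NavierStokesRegularity.NavierStokesRegularity.Theorems.rotatedDssBlowupBridge_proof` (its module imports this route file, so no `_holds` link can be stated here).

/-- item stmt-NavierStokesRegularity-1419 · support · rank 9 · open · by planner
sources: MajdaBertozzi2002, GinibreLeberrePomeau2019, Chae2007
[support] EXACT MOMENT LAWS (provable now: calculus + Euler conservation laws under rapid decay).
For ε > 0 and a classical solution (W, q) on ℝ×ℝ³ of NS with viscosity ε and force −(ε/2)(W + y·∇W)
— i.e. the rescaled Euler–Leray system ∂_σW + W·∇W + ∇q = ε(ΔW − ½(W + y·∇W)) — with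
HasUniformRapidDecayOn univ W: d/dσ ∫ y × curl W = ε ∫ y × curl W; d/dσ ∫ |y|²·curl W = (3ε/2) ∫
|y|²·curl W; d/dσ ∫|W|² = ε(½∫|W|² − 2∫|∇W|²_F); d/dσ helicity(W σ) = −2ε ∫⟨curl W, curl curl W⟩.
Ingredients: Euler conserves impulse, angular impulse, energy, helicity (MajdaBertozzi2002 §1.7;
in-tree IsClassicalEulerSolutionOn.helicity_eq_holds); viscosity: ∫ y × ΔΩ = 0, ∫|y|²ΔΩ = 6∫Ω = 0,
∫W·ΔW = −∫|∇W|²_F, Δ-helicity = −2∫Ω·curl Ω; drift (curl(W + y·∇W) = 2Ω + y·∇Ω): ∫ y × (2Ω + y·∇Ω) =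
−2∫ y × Ω, ∫|y|²(2Ω + y·∇Ω) = −3∫|y|²Ω, ∫ W·(W + y·∇W) = −½∫|W|², degree-0 cancellation for
helicity; the pressure gradient decays because every other term does. Consequence = the selection
rules: a solution periodic modulo an isometry has ∫ y × Ω ≡ 0, ∫|y|²Ω ≡ 0, ⟨∫|∇W|²⟩ = ¼⟨∫|W|²⟩,
⟨∫Ω·curl Ω⟩ = 0. (Under rapid VELOCITY decay the impulse law reads 0 = 0; the dipole-rate version
|W| ≲ |y|⁻³ with rapidly decaying vortici -/
@[route_item "route-NavierStokesRegularity-EulerMelnikovDss"]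
def PeriodMomentLaws : Prop :=
  ∀ (ε : ℝ) (W : ℝ → EuclideanSpace ℝ (Fin 3) → EuclideanSpace ℝ (Fin 3)) (q : ℝ → EuclideanSpace ℝ (Fin 3) → ℝ), 0 < ε → Literature.Analysis.FluidPDE.IsClassicalNSSolutionOn Set.univ ε (fun σ y => -((ε / 2) • (W σ y + fderiv ℝ (W σ) y y))) W q → Literature.Analysis.FluidPDE.HasUniformRapidDecayOn Set.univ W → (∀ σ, HasDerivAt (fun s => ∫ y, Literature.Analysis.FluidPDE.cross y (Literature.Analysis.FluidPDE.curl (W s) y)) (ε • ∫ y, Literature.Analysis.FluidPDE.cross y (Literature.Analysis.FluidPDE.curl (W σ) y)) σ) ∧ (∀ σ, HasDerivAt (fun s => ∫ y, (‖y‖ ^ 2) • Literature.Analysis.FluidPDE.curl (W s) y) ((3 * ε / 2) • ∫ y, (‖y‖ ^ 2) • Literature.Analysis.FluidPDE.curl (W σ) y) σ) ∧ (∀ σ, HasDerivAt (fun s => ∫ y, ‖W s y‖ ^ 2) (ε * ((1 / 2) * ∫ y, ‖W σ y‖ ^ 2 - 2 * ∫ y, Literature.Analysis.FluidPDE.frobeniusNormSq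 (fderiv ℝ (W σ) y))) σ) ∧ (∀ σ, HasDerivAt (fun s => Literature.Analysis.FluidPDE.helicity (W s)) (-(2 * ε) * ∫ y, inner ℝ (Literature.Analysis.FluidPDE.curl (W σ) y) (Literature.Analysis.FluidPDE.curl (Literature.Analysis.FluidPDE.curl (W σ)) y)) σ)

-- earlier Assembly (stmt-NavierStokesRegularity-10366, replaced 2026-08-15T16:16:36Z -> stmt-NavierStokesRegularity-10474): retired by None — FastBranchProfiles → DssTruncationBridge → ClayUniqueness → ¬ _root_.NavierStokesRegularity
-- earlier Assembly (stmt-NavierStokesRegularity-1420, replaced 2026-08-15T16:13:07Z -> stmt-NavierStokesRegularity-10366): retired by None — (∀ δ : ℝ, 0 < δ → ∃ c : ℝ, 1 < c ∧ c < 1 + δ ∧ ∃ R : EuclideanSpace ℝ (Fin 3) ≃ₗᵢ[ℝ] EuclideanSpace ℝ (Fin 3), ¬ Literature.Analysis.FluidPDE.RotatedTypeIDSSLiouville c R) → (¬ Literature.Analysis.FluidPDE.TypeIDSSLiouvilleConjecture → ∃ ν : ℝ, 0 < ν ∧ ∃ T : ℝ,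
/-- item stmt-NavierStokesRegularity-10474 · assembly · rank 1 · closed · proved by Summit.NavierStokesRegularity.NavierStokesRegularity.Theorems.eulerMelnikovDss_assembly_proof (prover) · by planner
sources: Fefferman2000
[assembly] FastBranchProfiles → RotatedDssBlowupBridge → ClayUniqueness (X5b) →
¬NavierStokesRegularity, by name over the route items; exactly the type of the deciding theorem
`closes` (D-0027 §2.1). Proof (in closes): δ := 1 in FastBranchProfiles gives c ∈ (1,2), R ∈ O(3)
with ¬RotatedTypeIDSSLiouville c R; the rotated truncation bridge gives a maximal smooth Leray–Hopf
solution with finite lifespan from a rapidly decaying datum (X5a); Clay (A) on that datum + X5b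
uniqueness extends it past T, contradiction (Literature.NS.blowup_assembly inlined). [sources:
Fefferman2000] -/
@[route_item "route-NavierStokesRegularity-EulerMelnikovDss"]
def Assembly : Prop :=
  FastBranchProfiles → RotatedDssBlowupBridge → ClayUniqueness → ¬ _root_.NavierStokesRegularity

-- `Assembly` holds: proved by `Summit.NavierStokesRegularity.NavierStokesRegularity.Theorems.eulerMelnikovDss_assembly_proof` (its module imports this route file, so no `_holds` link can be stated here).

/-! D-0027 §2.1 — DECIDING THEOREM (planner-authored via `route open/edit --closes-file`; by planner-rbadge-NavierStokesRegularity-EulerMel-cbbae676-g2-0 2026-08-15T16:16:36Z):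
its hypotheses are this route's items and its conclusion the sub-problem Statement (glue_lint), and it elaborates with this file. -/

@[closes "route-NavierStokesRegularity-EulerMelnikovDss"] theorem closes (hF : FastBranchProfiles) (hB : RotatedDssBlowupBridge) (hU : ClayUniqueness) :
    ¬ _root_.NavierStokesRegularity := by
  -- δ := 1 in the fast-branch crux gives a factor c ∈ (1, 2) and a rotation R with
  -- ¬ RotatedTypeIDSSLiouville c R; the (rotated-form) truncation bridge turns that into a maximal
  -- smooth Leray–Hopf solution with finite lifespan T from a rapidly decaying datum (X5a).
  obtain ⟨ν, hν, T, hT, u, p, ⟨hcl, hmax⟩, hLH, hdec⟩ :=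
    hB (by
      obtain ⟨c, -, -, R, hR⟩ := hF 1 one_pos
      exact ⟨c, R, hR⟩)
  -- Clay (A) applied to the datum u 0, glued to u on [0, T) by class-(A) uniqueness (X5b),
  -- extends u smoothly past T — contradicting maximality (the content of
  -- Literature.NS.blowup_assembly, inlined so that the route file needs no extra import).
  intro hA
  have h0 : (0 : ℝ) ∈ Set.Ico 0 T := ⟨le_rfl, hT⟩
  obtain ⟨u', p', hu', hp', hns, hbe⟩ :=
    hA ν hν (u 0) (hcl.contDiff_velocity h0) (hcl.divFree 0 h0) hdec
  have heq : ∀ t ∈ Set.Ico 0 T, u' t = u t :=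
    hU ν hν (u 0) hdec u' u p' p T hT hu' hp' hns hbe hcl hLH rfl
  have hcl' : Literature.Analysis.FluidPDE.IsClassicalNSSolutionOn (Set.Ici 0) ν 0 u' p' :=
    ⟨hu', hp', fun t ht x => hns.momentum t ht x, fun t ht => hns.divFree t ht⟩
  refine hmax ⟨T + 1, by linarith, u', p', ?_, heq⟩
  exact hcl'.mono (fun t ht => ht.1) (uniqueDiffOn_Ico 0 (T + 1))

end Summit.NavierStokesRegularity.NavierStokesRegularity.Theses.EulerMelnikovDss
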